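import Mathlib
import HarnessLib
import HarnessLib.Audit
import Summits.QuantumFields.Statement
import Summits.QuantumFields.QCD.Theorems.QuarkMassMonotoneMassDerivativeIdentity

/-!
Route: EulerDescent

DORMANT since 2026-09-03T10:19:53Z (reconciler: no traction for 5 d (last activity statement-checked at 2026-08-29T09:24:21Z); parked, not closed — `ledger route dormant route-QuantumFields-EulerDescent --off` to reactivate) — unstaffed, not closed; items shared with open routes are served there. `ledger route dormant <id> --off` reactivates.

# Route EulerDescent — the gap is monotone in Λ — Euler descent of the heavy-threshold gap to every
quark mass, pinned at the Wilson corner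

It suffices to show X = RayDescent ∧ HonestHeavyAnchor ∧ ChiralCornerSoftness ∧
RetypedContinuumComplement. Since the re-type of
2026-08-16 the conjunct is `QCDOf N_f := ∃ reg, HasMassScaling ∧ IsChiralAtZero ∧ ∀ m > 0, body`:
the additive mass renormalisation is
PINNED to the chiral point, so the threshold shift `m_crit ↦ m_crit + a_k M₀/Z_m` that closed every
heavy-threshold line is dead and a
DESCENT from the threshold body to all positive masses is now load-bearing. HonestHeavyAnchor (rank
3): for N_f ∈ {2,3} ONE
mass-independent, asymptotically scaling, mass-scaling regularisation whose `m_crit(k)` sits within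
`o(a_k/Z_m(k))` of the INTRINSIC
Wilson corner `m_c(β_k)` (the least upper bound of the degenerate bare masses at which lattice QCD
at coupling β_k is NOT massive) and
which carries the full body of `QCDOf` (OS data, non-trivial non-Gaussian glue, dynamical quarks,
continuum + lattice gap) for every tuple
with all `m_f ≥ M_h`. RayDescent (rank 2, the NEW LEVER): for every such pinned regularisation,
along every mass ray the uniform lattice
gap transports DOWN with loss `1/l`: gap Δ at `l·m` (l ≥ 1) ⇒ gap Δ' at `m` for every `Δ' < Δ/l` —
by Euler's identity for the
1-homogeneous function Δ(Λ, m) this is "sigma fraction of the lightest state ≤ 1" ⇔ `∂Δ/∂Λ|_m ≥ 0` ⇔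
non-negative trace-anomaly share.
ChiralCornerSoftness (rank 4): a pinned regularisation is chiral at zero (`IsChiralAtZero`).
RetypedContinuumComplement (rank 5): heavy
body + lattice gap at every positive tuple ⇒ body at every positive tuple, for the SAME
regularisation. No card realised (novel-route seat);
the lever is the pool card sigma-fraction-gronwall-mass-transport (closed 2026-08-15 as "not
load-bearing under the threshold reading"),
re-made load-bearing by the re-type and sharpened to the Euler constant C = 1 and an intrinsic pin.
Lean: `RayDescent ∧ HonestHeavyAnchor ∧ ChiralCornerSoftness ∧ RetypedContinuumComplement`

## Assembly
Pure logic plus one line of real arithmetic (sorry-free in the planner's Sketch.lean / glue.lean,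
axioms propext / Classical.choice /
Quot.sound): fix N_f ∈ {2,3}; HonestHeavyAnchor gives reg, mc, M_h with corner, pin, HasMassScaling,
asymptotic scaling, physical branch and
the heavy body; for a positive tuple m put l := 1 + Σ_f M_h/m_f ≥ 1, so l·m_f ≥ M_h for every f and
the heavy body gives a lattice gap Δ at
l·m (the clause reads only a, β, L, mq — definitionally independent of z, shift); RayDescent gives
HasLatticeMassGap (Δ/l/2) at m;
ChiralCornerSoftness gives reg.IsChiralAtZero; RetypedContinuumComplement turns heavy body + lattice
gap everywhere into the body at every
positive tuple; hence QCDOf N_f = ⟨reg, HasMassScaling, IsChiralAtZero, body⟩ and QCD = QCDOf 2 ∧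
QCDOf 3.

Rationale: WHY THIS LINE. Write the gap as a 1-homogeneous function Δ(Λ, m₁,…,m_{N_f}) of the RGI scale and
masses; Euler gives Λ∂_ΛΔ + Σ_f m_f ∂_fΔ = Δ, so the
single sign `∂Δ/∂Λ|_m ≥ 0` ("strengthening the interaction never lowers the lightest mass") is
equivalent to `d log Δ(l·m)/d log l ≤ 1`,
i.e. to the integrated descent `Δ(m) ≥ Δ(l·m)/l`: a linear lower bound Δ(m) ≥ m·Δ(M_h)/M_h for every
positive tuple from ONE heavy
anchor, consistent with the Goldstone law Δ ≍ √m (share 1/2, GellmannOakesRenner1968,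
GasserLeutwyler1984) and with heavy decoupling
(Δ ∝ Λ^{1−2N_f/33} m^{2N_f/33}, share 2N_f/33, AppelquistCarazzone1975); physically it is the
non-negativity of the trace-anomaly
(gluonic) share of the lightest hadron's mass in Ji's decomposition (Ji1995; lattice: YangEtAl2015
p. 6, "all these contributions are
positive" for pseudoscalars at every valence mass below charm; its β-direction twin is Michael's
action sum rule, Michael1987). The
lattice content is Feynman–Hellmann in the bare mass on Lüscher's positive transfer matrix
(Luscher1977, OsterwalderSeiler1978;
MontvayMunster1994 §5.1), i.e. `G(β, m₀)/(m₀ − m_c(β))` antitone in m₀ at fixed β, which forces the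
route to define `m_c(β)`
INTRINSICALLY (least upper bound of the non-massive degenerate bare masses) and to pin `reg.mcrit`
to it — the same pin the chiral
clause needs. Imported areas: first-order spectral perturbation theory (Kato1966), QCD mass
inequalities (NussinovLampert2002 §20, which
has orderings between channels and the SIGN of ∂M/∂m, never an upper bound on the log-derivative),
dimensional analysis. What it does that
no open route does: QuarkMassMonotone transports the SAME rate UP the mass axis from a LIGHT anchor
by the sigma sign σ ≥ 0; this line
transports a LOSSY rate DOWN from the HEAVY anchor (where decoupling theorems live) by the companion
bound σ·m ≤ Δ, re-wires the
heavy-threshold family (HeavyThresholdYMBridge, NestedDissectionSea, RenormalisedVafaWitten, …) to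
the re-typed statement through one
typed descent, one typed pin and one re-typed continuum complement, and states the chiral clause for
pinned regularisations so that
AnomalyRigidity / ChiralSpinWaves can discharge it.

RANKED CRUXES. #2 RayDescent (crux) — for every N_f, every regularisation reg and candidate corner
mc: IF eventually in k mc(k) is the least upper bound of the degenerate bare Wilson masses μ at
which lattice QCD at coupling β_k is not massive (some pair of gauge-invariant local observables
fails to cluster at any lattice rate uniformly in the volume), AND (reg.mcrit(k) − mc(k))·Z_m(k)/a_k
→ 0, AND reg has leading-log mass scaling, two-loop asymptotic scaling and reg.mcrit(k) > −1
eventually (Lüscher positivity range), THEN for every positive tuple m, every l ≥ 1 and every Δ > 0: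
`HasLatticeMassGap Δ` at the tuple l·m implies `HasLatticeMassGap Δ'` at m for every 0 < Δ' < Δ/l
(Euler descent: Δ(m) ≥ Δ(l m)/l). [difficulty: open-problem] (why it might fail: a lightest state
with NEGATIVE trace-anomaly share (Coulombic quarkonium has d log M/d log m > 1, but is never
lightest: glueball below 2m); a lattice-artefact non-massive point above the chiral corner at weak
coupling would mis-pin mc.) [Ji1995, YangEtAl2015, Michael1987, NussinovLampert2002, Luscher1977,
Kato1966, MontvayMunster1994]
#3 HonestHeavyAnchor (crux) — for N_f ∈ {2,3} there are a regularisation reg, a corner sequence mc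
and M_h > 0 with: eventually mc(k) is the least upper bound of the non-massive degenerate bare
masses at β_k; (reg.mcrit(k) − mc(k))·Z_m(k)/a_k → 0 (PIN); HasMassScaling; two-loop asymptotic
scaling; reg.mcrit(k) > −1 eventually; and for every tuple with all m_f ≥ M_h there are species
renormalisations z, shift and OS data T with IsQCDAlong (reg.scheme m z shift) T, non-trivial
non-Gaussian glue, every flavour-changing pseudoscalar non-trivial, and one Δ > 0 with T.HasMassGap
Δ and (reg.scheme m z shift).HasLatticeMassGap Δ — the threshold body of the heavy-threshold family
for an HONESTLY PINNED regularisation. [difficulty: open-problem] (why it might fail: contains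
robust SU(3) Yang–Mills (glueball gap along AF sequences) via decoupling; the pin asks m_crit to
o(a/Z_m), beyond the O(aΛ) renormalon ambiguity (non-perturbative critical-mass tuning); IsLUB needs
the YM sector at β_k to cluster for all heavy masses.) [AppelquistCarazzone1975,
Balaban1988Convergent, BalabanOcarrollSchor1989, JaffeWitten2000, MontvayMunster1994,
SharpeSingleton1998]
#4 ChiralCornerSoftness (crux) — for N_f ∈ {2,3}, every regularisation pinned at the intrinsic
corner (hypotheses of RayDescent: corner eventually, pin → 0, HasMassScaling, asymptotic scaling,
mcrit > −1 eventually) is chiral at zero: `reg.IsChiralAtZero` — for every ε > 0 some positive tuple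
has no uniform lattice gap ε (the gap closes as m → 0⁺: Goldstone law if chiral symmetry breaks, 't
Hooft anomaly matching otherwise). [deps: HonestHeavyAnchor] [difficulty: open-problem] (why it
might fail: false iff massless N_f = 2,3 Wilson-lattice QCD were gapped with unbroken chiral
symmetry (excluded only by the physical anomaly-matching argument, no OS-level proof), or if the top
non-massive bare mass at weak coupling is a lattice artefact above κ_c.) [GellmannOakesRenner1968,
GasserLeutwyler1984, tHooft1980Naturalness, SharpeSingleton1998, Aoki1984WilsonPhase,
EdwardsHellerNarayanan1998]
#5 RetypedContinuumComplement (crux) — for N_f ∈ {2,3} and every regularisation with HasMassScaling,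
two-loop asymptotic scaling and reg.mcrit(k) > −1 eventually: IF it carries the heavy body above
some M_h > 0 (as in HonestHeavyAnchor) AND a uniform lattice gap Δ(m) > 0 at EVERY positive tuple,
THEN it carries the full body of QCDOf at every positive tuple (species renormalisations, OS data
with IsQCDAlong, non-trivial non-Gaussian glue, dynamical quarks, T.HasMassGap Δ ∧ HasLatticeMassGap
Δ) — the continuum complement of the lattice-first lines, RE-TYPED so that the same reg serves (no
threshold shift). [deps: HonestHeavyAnchor, RayDescent] [difficulty: XL] (why it might fail: UV
stability with LIGHT dynamical Wilson quarks along one sequence for uncountably many masses (E0′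
off-diagonal bounds, E1 rotation restoration, mass-equicontinuity) is proved for no 4D gauge theory;
the refuters' periodic-seam/coincident-support traps of DiagonalSpine apply to any proof.)
[OsterwalderSeiler1978, GlimmJaffeQP1987, Balaban1988Convergent, BalabanOcarrollSchor1989,
Luscher1977, JaffeWitten2000]
#9 MassDerivativeIdentity (support) — (re-asked verbatim from route QuarkMassMonotone — the first
lemma of any proof of RayDescent) Feynman–Hellmann in the quark mass on the finite torus: if the
fermionic partition function is non-zero, μ ↦ ⟨A⟩ at bare masses mq[f ↦ μ] has derivative −(⟨A·Σ_f⟩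
− ⟨A⟩⟨Σ_f⟩) at μ = mq_f, Σ_f the flavour-f scalar density summed over the torus. [difficulty:
provable-now] [MontvayMunster1994, NussinovLampert2002]

TWO-LAYER PLAN. RayDescent ⇐ FiniteVolumeEuler (Feynman–Hellmann/Kato on Lüscher's transfer matrix
at fixed (k, S): the gap is locally Lipschitz in the
bare masses with derivative the connected scalar-density content of the lightest level; a
RENORMALISED sigma bound Σ_f (m₀,f − m_c)∂_f G ≤ G
uniform in S) → VolumeUniformPassage (S → ∞ at fixed k, (−1)^F-twisted finite-torus bookkeeping) →
RayDescent. HonestHeavyAnchor ⇐ the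
heavy-threshold family's ConstructiveDecouplingRG-type node + CornerPin (the flow-tuned critical
mass IS the intrinsic corner to o(a/Z_m)).
RetypedContinuumComplement ⇐ DiagonalSpine-type calibrated tightness → mass-equicontinuity → OS
closure. Nothing filed now (k ≤ 3, depth 1).

KILL CRITERIA. A tuple, ray and regularisation with Δ(m) < Δ(l·m)/l — e.g. lattice data with the
lightest state's quark-mass share Σ_f m_f ∂M/∂m_f > M at
some simulated point of the DEGENERATE-sea theory — refutes RayDescent as typed (C = 1): repair by
restating with a constant, Δ' < Δ/l^C,
∃ C ≥ 1 (misstated class; the assembly only needs SOME positive transported rate); a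
super-polynomial collapse of the gap at positive mass
(a phase wall in m > 0) kills the line outright (close refuted:RayDescent). A weak-coupling
lattice-artefact transition on the Wilson mass
axis ABOVE κ_c refutes the intrinsic pin (ChiralCornerSoftness misstated: re-pin to the top
non-massive point in (−1, 0]). Proof of
FullLatticeGap-with-pin elsewhere moots RayDescent; AnomalyRigidity's chain proved moots
ChiralCornerSoftness.

NOT DECOMPOSED YET. The finite-volume Feynman–Hellmann/Kato lemma and the S → ∞ passage (children of
RayDescent); the decoupling construction and the o(a/Z_m)
corner pin (children of HonestHeavyAnchor, shared in substance with HeavyThresholdYMBridge /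
NestedDissectionSea); E1, calibrated tightness
and mass-equicontinuity (children of RetypedContinuumComplement, shared in substance with
DiagonalSpine); the two-flavour vs three-flavour
split of ChiralCornerSoftness (anomaly index obstruction only for N_f = 3).

CHEAPEST FALSIFIER. Published lattice hadron masses versus quark mass: the ratio
M_lightest/m_q^{RGI} must be NON-INCREASING in m_q along (near-)degenerate
trajectories. Checked this session against YangEtAl2015 (arXiv:1405.4440, p. 6: for pseudoscalars M
− ⟨H_m⟩ > 0 at every valence mass
below charm, share ⟨H_m⟩/M ≈ 1/2 for light pions) and PDG quarkonia (d log M_PS/d log m between c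
and b ≈ 0.97 < 1; above b the
Coulombic ratio exceeds 1 but the glueball is lighter there) — passes. Theory-side: the β = 0
strong-coupling meson masses of r = 1 Wilson
fermions (Kawamoto–Smit): a m_PS/(m₀ − m_c(0)) must be antitone on (m_c, ∞) — a one-page computation
a refuter can run first.

NUMBERS. Euler shares d log Δ/d log m of the lightest state: 1/2 (GMOR regime), 2N_f/33 = 4/33, 6/33
(heavy degenerate N_f = 2, 3: glueball with
Λ_YM ∝ Λ^{1−2N_f/33} m^{2N_f/33}), ≈ 0.97 (c→b pseudoscalar quarkonium, not lightest), → 1⁺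
(Coulombic limit, not lightest). Items at open: 6.

DEFINITION REQUESTS. None filed: the intrinsic corner and the pin are inlined (IsLUB over
`qcdLatticeConnectedCorr` clustering; Tendsto of
(mcrit − mc)·Z_m/a). A Literature definition `WilsonCriticalBareMass N_f β` (LUB of non-massive
degenerate bare masses) would shorten the
four statements; to be requested if a second route wants it.

Novelty: Searches (2026-08-16): `lit search --source arxiv "hadron mass decomposition trace anomaly pion
lattice"` (3: arXiv:1405.4440, 1411.0927,
2503.12208); `lit search --source arxiv "quantum anomalous energy positivity nucleon mass"` (1,
irrelevant); `lit search --source crossref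
"Ji QCD analysis of the mass structure of the nucleon 1995"` (found
doi:10.1103/physrevlett.74.1071); `lit galaxy search "Feynman-Hellmann
theorem quark mass" --star all` (0) and `"sigma term" --star pdf` (8, none relevant); `lit frontier
QuantumFields --since 2022` (30 rows,
none on mass transport); `lit bridges QuantumFields --cross any`; local `lit search` daemon
unavailable (connection reset, retried); all 29
QCD Theses headers, the 12 open and 24 closed QCD idea cards, `ledger negatives --problem
QuantumFields` (4, none touched) read in full.
Nearest prior art found: pool card QuantumFields/QCD/sigma-fraction-gronwall-mass-transport (closed
2026-08-15, new-combination: Δ(m) ≥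
Δ(λm)λ^{−C} from a sigma-fraction bound — declined only because ThresholdShift then made it idle);
route QuantumFields-QuarkMassMonotone
(FH sign σ ≥ 0, same-rate transport UP from a light anchor); NussinovLampert2002 §20 (sign of ∂M/∂m
only); Ji1995 / YangEtAl2015 (trace
anomaly share, physics and lattice data, no theorem); pool card complex-mass-harnack-transport
(closed, variant: complex-m analyticity).
Delta: the first ROUTE to carry the threshold family's output to the re-typed statement — a lossy
DOWNWARD transport with t  [refs: 10.1103/physrevlett.74.1071, 1405.4440, doi:10.1103/physrevlett.74.1071, NussinovLampert2002, Ji1995, YangEtAl2015]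

Barriers (technique_class: feynman-hellmann, euler-homogeneity, threshold-descent): - technique_class: feynman-hellmann, euler-homogeneity, threshold-descent
- Literature.Barriers.QuantumFields.tHooftAnomalyMatching: its class is mass-UNIFORM gap mechanisms;
RayDescent's bound Δ(m) ≥ m·Δ(M_h)/M_h degrades linearly as m → 0⁺ and ChiralCornerSoftness asserts
gaplessness at the corner — the barrier is the physics behind crux 4, not against it.
- Literature.Barriers.QuantumFields.GoldstoneTheorem and .BanksCasherCriterion: no condensate, no
Dirac spectral density at 0 and no m = 0 theory is ever used; the descent stops at every m > 0; crux
4 is stated as gaplessness, not as symmetry breaking.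
- Literature.Barriers.QuantumFields.VafaWittenEigenvalueBound: not in class — no configuration-wise
propagator bound and no BARE-mass rate; the transported rate is the heavy anchor's PHYSICAL rate
times m/M_h, so the log running of Z_m (RenormalisedVafaWitten's diagnosis) never enters.
- Literature.Barriers.QuantumFields.HoppingExpansionUniformGap: no expansion in κ anywhere;
strong-coupling/hopping formulas appear only as the cheapest falsifier.
- Literature.Barriers.QuantumFields.PerturbativeInvisibility: gap values are never expanded in g₀;
only the RESPONSE of the gap to the mass is bounded, and the anchor's gap is imported.
- Literature.Barriers.QuantumFields.AokiPhaseDichotomy: every tuple the descent touches sits a m/Z_m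
≫ a³Λ³ above the corner eventually in k; the Aoki fingers / first-order point lie AT the corner,
which is defined as the least upper bound of exactl

History (route lifecycle, newest last):
- 2026-08-25T08:16:09Z · DORMANT — reconciler: no traction for 7.5 d (last activity item-evidence-added at 2026-08-17T19:06:15Z); parked, not closed — `ledger route dormant route-QuantumFields-Eu (operator:999:82859)
- 2026-08-28T21:14:42Z · REACTIVATED — reconciler: reactivated — activity statement-closed at 2026-08-28T18:38:53Z after parking at 2026-08-25T08:16:09Z (operator:999:2234332)
- 2026-09-03T10:19:53Z · DORMANT — reconciler: no traction for 5 d (last activity statement-checked at 2026-08-29T09:24:21Z); parked, not closed — `ledger route dormant route-QuantumFields-EulerD (operator:999:388730)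

sub-problem: QCD · status: dormant · opened planner-plan-novel-QuantumFields-QCD-829546d5-v2-g10-0 2026-08-16T21:30:19Z · rev 1 · ledger route-QuantumFields-EulerDescent
GENERATED by the gate from the ledger (D-0016/17). Provers cite these decls: `theorem foo : Summit.QuantumFields.QCD.Theses.EulerDescent.<Decl> := …` in Summits/QuantumFields/QCD/Theorems/<Name>.lean.
-/

namespace Summit.QuantumFields.QCD.Theses.EulerDescent

open scoped BigOperators Topology Manifold Classical MeasureTheory ProbabilityTheory Matrix InnerProductSpace ComplexConjugate ContinuousMap
open Filter Set Function TopologicalSpace MeasureTheory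

attribute [summit_statement] _root_.QCD

/-- item stmt-QuantumFields-16900 · crux · rank 2 · open · by planner
why it might fail: a lightest state with NEGATIVE trace-anomaly share (Coulombic quarkonium has d log M/d log m > 1, but is never lightest: glueball below 2m); a lattice-artefact non-massive point above the chiral corner at weak coupling would mis-pin mc.
sources: Ji1995, YangEtAl2015, Michael1987, NussinovLampert2002, Luscher1977, Kato1966
[crux] for every N_f, every regularisation reg and candidate corner mc: IF eventually in k mc(k) is
the least upper bound of the degenerate bare Wilson masses μ at which lattice QCD at coupling β_k is
not massive (some pair of gauge-invariant local observables fails to cluster at any lattice rate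
uniformly in the volume), AND (reg.mcrit(k) − mc(k))·Z_m(k)/a_k → 0, AND reg has leading-log mass
scaling, two-loop asymptotic scaling and reg.mcrit(k) > −1 eventually (Lüscher positivity range),
THEN for every positive tuple m, every l ≥ 1 and every Δ > 0: `HasLatticeMassGap Δ` at the tuple l·m
implies `HasLatticeMassGap Δ'` at m for every 0 < Δ' < Δ/l (Euler descent: Δ(m) ≥ Δ(l m)/l).
[difficulty: open-problem] -/
@[route_item "route-QuantumFields-EulerDescent"]
def RayDescent : Prop :=
  ∀ (Nf : ℕ) (reg : Literature.MathematicalPhysics.QuantumFieldTheory.QCDRegularisation Nf) (mc : ℕ → ℝ), (∀ᶠ k in Filter.atTop, IsLUB {μ : ℝ | ¬ (∀ (R R' : ℕ) (A : Literature.MathematicalPhysics.QuantumFieldTheory.QCDLatticeObservable Nf R) (B : Literature.MathematicalPhysics.QuantumFieldTheory.QCDLatticeObservable Nf R'), ∃ (C δ : ℝ) (S₀ : ℕ), 0 < δ ∧ ∀ S : ℕ, S₀ ≤ S → ∀ n : ℕ, n ≤ S → ‖Literature.MathematicalPhysics.QuantumFieldTheory.qcdLatticeConnectedCorr (reg.β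 k) (2 * S + 1) (fun _ : Fin Nf => μ) A B n‖ ≤ C * Real.exp (-(δ * n)))} (mc k)) → Filter.Tendsto (fun k => (reg.mcrit k - mc k) * reg.Zm k / reg.a k) Filter.atTop (nhds 0) → reg.HasMassScaling → (reg.scheme 0 0 0).HasAsymptoticScaling → (∀ᶠ k in Filter.atTop, (-1 : ℝ) < reg.mcrit k) → ∀ m : Fin Nf → ℝ, (∀ f, 0 < m f) → ∀ l : ℝ, 1 ≤ l → ∀ Δ : ℝ, 0 < Δ → (reg.scheme (fun f => l * m f) 0 0).HasLatticeMassGap Δ → ∀ Δ' : ℝ, 0 < Δ' → Δ' < Δ / l → (reg.scheme m 0 0).HasLatticeMassGap Δ'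

/-- item stmt-QuantumFields-16901 · crux · rank 3 · open · by planner
why it might fail: contains robust SU(3) Yang–Mills (glueball gap along AF sequences) via decoupling; the pin asks m_crit to o(a/Z_m), beyond the O(aΛ) renormalon ambiguity (non-perturbative critical-mass tuning); IsLUB needs the YM sector at β_k to cluster for all heavy masses.
sources: AppelquistCarazzone1975, Balaban1988Convergent, BalabanOcarrollSchor1989, JaffeWitten2000, MontvayMunster1994, SharpeSingleton1998
[crux] for N_f ∈ {2,3} there are a regularisation reg, a corner sequence mc and M_h > 0 with:
eventually mc(k) is the least upper bound of the non-massive degenerate bare masses at β_k;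
(reg.mcrit(k) − mc(k))·Z_m(k)/a_k → 0 (PIN); HasMassScaling; two-loop asymptotic scaling;
reg.mcrit(k) > −1 eventually; and for every tuple with all m_f ≥ M_h there are species
renormalisations z, shift and OS data T with IsQCDAlong (reg.scheme m z shift) T, non-trivial
non-Gaussian glue, every flavour-changing pseudoscalar non-trivial, and one Δ > 0 with T.HasMassGap
Δ and (reg.scheme m z shift).HasLatticeMassGap Δ — the threshold body of the heavy-threshold family
for an HONESTLY PINNED regularisation. [difficulty: open-problem] -/
@[route_item "route-QuantumFields-EulerDescent"]
def HonestHeavyAnchor : Prop :=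
  ∀ Nf : ℕ, Nf = 2 ∨ Nf = 3 → ∃ (reg : Literature.MathematicalPhysics.QuantumFieldTheory.QCDRegularisation Nf) (mc : ℕ → ℝ) (Mh : ℝ), (∀ᶠ k in Filter.atTop, IsLUB {μ : ℝ | ¬ (∀ (R R' : ℕ) (A : Literature.MathematicalPhysics.QuantumFieldTheory.QCDLatticeObservable Nf R) (B : Literature.MathematicalPhysics.QuantumFieldTheory.QCDLatticeObservable Nf R'), ∃ (C δ : ℝ) (S₀ : ℕ), 0 < δ ∧ ∀ S : ℕ, S₀ ≤ S → ∀ n : ℕ, n ≤ S → ‖Literature.MathematicalPhysics.QuantumFieldTheory.qcdLatticeConnectedCorr (reg.β k) (2 * S + 1) (fun _ : Fin Nf => μ) A B n‖ ≤ C * Real.exp (-(δ * n)))} (mc k)) ∧ Filter.Tendsto (fun k => (reg.mcrit k - mc k) * reg.Zm k / reg.a k) Filter.atTop (nhds 0) ∧ reg.HasMassScaling ∧ (reg.scheme 0 0 0).HasAsymptoticScaling ∧ (∀ᶠ k in Filter.atTop, (-1 : ℝ) < reg.mcrit k) ∧ 0 < Mh ∧ ∀ m : Fin Nf → ℝ,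 (∀ f, Mh ≤ m f) → ∃ (z shift : Literature.MathematicalPhysics.QuantumFieldTheory.QCDField Nf → ℕ → ℝ) (T : Literature.MathematicalPhysics.QuantumFieldTheory.OSData (Literature.MathematicalPhysics.QuantumFieldTheory.QCDField Nf) 4), Literature.MathematicalPhysics.QuantumFieldTheory.IsQCDAlong (reg.scheme m z shift) T ∧ T.IsNontrivial Literature.MathematicalPhysics.QuantumFieldTheory.QCDField.glue ∧ T.IsNonGaussian Literature.MathematicalPhysics.QuantumFieldTheory.QCDField.glue ∧ (∀ f g : Fin Nf, f ≠ g → T.IsNontrivial (Literature.MathematicalPhysics.QuantumFieldTheory.QCDField.pseudoRe f g)) ∧ ∃ Δ > 0, T.HasMassGap Δ ∧ (reg.scheme m z shift).HasLatticeMassGap Δ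

/-- item stmt-QuantumFields-16902 · crux · rank 4 · open · by planner
why it might fail: false iff massless N_f = 2,3 Wilson-lattice QCD were gapped with unbroken chiral symmetry (excluded only by the physical anomaly-matching argument, no OS-level proof), or if the top non-massive bare mass at weak coupling is a lattice artefact above κ_c.
sources: GellmannOakesRenner1968, GasserLeutwyler1984, tHooft1980Naturalness, SharpeSingleton1998, Aoki1984WilsonPhase, EdwardsHellerNarayanan1998
[crux] for N_f ∈ {2,3}, every regularisation pinned at the intrinsic corner (hypotheses of
RayDescent: corner eventually, pin → 0, HasMassScaling, asymptotic scaling, mcrit > −1 eventually)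
is chiral at zero: `reg.IsChiralAtZero` — for every ε > 0 some positive tuple has no uniform lattice
gap ε (the gap closes as m → 0⁺: Goldstone law if chiral symmetry breaks, 't Hooft anomaly matching
otherwise). [deps: HonestHeavyAnchor] [difficulty: open-problem] -/
@[route_item "route-QuantumFields-EulerDescent"]
def ChiralCornerSoftness : Prop :=
  ∀ Nf : ℕ, Nf = 2 ∨ Nf = 3 → ∀ (reg : Literature.MathematicalPhysics.QuantumFieldTheory.QCDRegularisation Nf) (mc : ℕ → ℝ), (∀ᶠ k in Filter.atTop, IsLUB {μ : ℝ | ¬ (∀ (R R' : ℕ) (A : Literature.MathematicalPhysics.QuantumFieldTheory.QCDLatticeObservable Nf R) (B : Literature.MathematicalPhysics.QuantumFieldTheory.QCDLatticeObservable Nf R'), ∃ (C δ : ℝ) (S₀ : ℕ), 0 < δ ∧ ∀ S : ℕ, S₀ ≤ S → ∀ n : ℕ, n ≤ S → ‖Literature.MathematicalPhysics.QuantumFieldTheory.qcdLatticeConnectedCorr (reg.β k) (2 * S + 1) (fun _ : Fin Nf => μ) A B n‖ ≤ C * Real.exp (-(δ * n)))} (mc k)) → Filter.Tendsto (fun k =>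 (reg.mcrit k - mc k) * reg.Zm k / reg.a k) Filter.atTop (nhds 0) → reg.HasMassScaling → (reg.scheme 0 0 0).HasAsymptoticScaling → (∀ᶠ k in Filter.atTop, (-1 : ℝ) < reg.mcrit k) → reg.IsChiralAtZero

/-- item stmt-QuantumFields-16903 · crux · rank 5 · open · by planner
why it might fail: UV stability with LIGHT dynamical Wilson quarks along one sequence for uncountably many masses (E0′ off-diagonal bounds, E1 rotation restoration, mass-equicontinuity) is proved for no 4D gauge theory; the refuters' periodic-seam/coincident-support traps of DiagonalSpine apply to any proof.
sources: OsterwalderSeiler1978, GlimmJaffeQP1987, Balaban1988Convergent, BalabanOcarrollSchor1989, Luscher1977, JaffeWitten2000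
[crux] for N_f ∈ {2,3} and every regularisation with HasMassScaling, two-loop asymptotic scaling and
reg.mcrit(k) > −1 eventually: IF it carries the heavy body above some M_h > 0 (as in
HonestHeavyAnchor) AND a uniform lattice gap Δ(m) > 0 at EVERY positive tuple, THEN it carries the
full body of QCDOf at every positive tuple (species renormalisations, OS data with IsQCDAlong,
non-trivial non-Gaussian glue, dynamical quarks, T.HasMassGap Δ ∧ HasLatticeMassGap Δ) — the
continuum complement of the lattice-first lines, RE-TYPED so that the same reg serves (no threshold
shift). [deps: HonestHeavyAnchor, RayDescent] [difficulty: XL] -/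
@[route_item "route-QuantumFields-EulerDescent"]
def RetypedContinuumComplement : Prop :=
  ∀ Nf : ℕ, Nf = 2 ∨ Nf = 3 → ∀ (reg : Literature.MathematicalPhysics.QuantumFieldTheory.QCDRegularisation Nf), reg.HasMassScaling → (reg.scheme 0 0 0).HasAsymptoticScaling → (∀ᶠ k in Filter.atTop, (-1 : ℝ) < reg.mcrit k) → (∃ Mh : ℝ, 0 < Mh ∧ ∀ m : Fin Nf → ℝ, (∀ f, Mh ≤ m f) → ∃ (z shift : Literature.MathematicalPhysics.QuantumFieldTheory.QCDField Nf → ℕ → ℝ) (T : Literature.MathematicalPhysics.QuantumFieldTheory.OSData (Literature.MathematicalPhysics.QuantumFieldTheory.QCDField Nf) 4), Literature.MathematicalPhysics.QuantumFieldTheory.IsQCDAlong (reg.scheme m z shift) T ∧ T.IsNontrivial Literature.MathematicalPhysics.QuantumFieldTheory.QCDField.glue ∧ T.IsNonGaussian Literature.MathematicalPhysics.QuantumFieldTheory.QCDField.glue ∧ (∀ f g : Fin Nf, f ≠ g → T.IsNontrivial (Literature.MathematicalPhysics.QuantumFieldTheory.QCDField.pseudoRe f g)) ∧ ∃ Δ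 > 0, T.HasMassGap Δ ∧ (reg.scheme m z shift).HasLatticeMassGap Δ) → (∀ m : Fin Nf → ℝ, (∀ f, 0 < m f) → ∃ Δ > 0, (reg.scheme m 0 0).HasLatticeMassGap Δ) → ∀ m : Fin Nf → ℝ, (∀ f, 0 < m f) → ∃ (z shift : Literature.MathematicalPhysics.QuantumFieldTheory.QCDField Nf → ℕ → ℝ) (T : Literature.MathematicalPhysics.QuantumFieldTheory.OSData (Literature.MathematicalPhysics.QuantumFieldTheory.QCDField Nf) 4), Literature.MathematicalPhysics.QuantumFieldTheory.IsQCDAlong (reg.scheme m z shift) T ∧ T.IsNontrivial Literature.MathematicalPhysics.QuantumFieldTheory.QCDField.glue ∧ T.IsNonGaussian Literature.MathematicalPhysics.QuantumFieldTheory.QCDField.glue ∧ (∀ f g : Fin Nf, f ≠ g → T.IsNontrivial (Literature.MathematicalPhysics.QuantumFieldTheory.QCDField.pseudoRe f g)) ∧ ∃ Δ > 0, T.HasMassGap Δ ∧ (reg.scheme m z shift).HasLatticeMassGap Δ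

/-- item stmt-QuantumFields-8909 · support · rank 9 · closed · proved by Summit.QuantumFields.QCD.Theorems.massDerivativeIdentity_proof @ 2196688ca625 (prover) · by planner
sources: MontvayMunster1994, NussinovLampert2002
[support] (card P2; the engine's first lemma — Feynman–Hellmann in the quark mass on the finite
torus, honest signed functional) For every N_f, β, S, bare tuple mq, flavour f, gauge-invariant
local observable A and placement v: if the fermionic partition function ∫dU ∫dψ̄dψ e^{−ψ̄D(U,mq)ψ}
on the torus of side 2S+1 is non-zero, then μ ↦ ⟨A⟩_{β,2S+1,mq[f↦μ]} (qcdTorusExpect with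
Function.update) has derivative −(⟨A·Σ_f⟩ − ⟨A⟩⟨Σ_f⟩) at μ = mq_f, where Σ_f = Σ_{x,a,α}
ψ̄_{(f,x,a,α)} ψ_{(f,x,a,α)}; because ∂_μ exp(quadratic(−D)) = −Σ_f·exp(quadratic(−D)) (even
elements commute) and the quotient rule. [difficulty: provable-now] -/
@[route_item "route-QuantumFields-EulerDescent"]
def MassDerivativeIdentity : Prop :=
  ∀ (Nf : ℕ) (β : ℝ) (S : ℕ) (mq : Fin Nf → ℝ) (f : Fin Nf) (R : ℕ) (A : Literature.MathematicalPhysics.QuantumFieldTheory.QCDLatticeObservable Nf R) (v : Literature.Probability.LatticeModels.Site 4), (∫ U, Literature.MathematicalPhysics.QuantumFieldTheory.fermiIntegral (Literature.MathematicalPhysics.QuantumFieldTheory.fermiBoltzmann U mq) ∂(Literature.MathematicalPhysics.QuantumFieldTheory.wilsonMeasure (d := 4) (L := 2 * S + 1) (Literature.MathematicalPhysics.QuantumLattice.fundamentalRep (Fin 3)) β)) ≠ 0 → HasDerivAt (fun μ : ℝ => Literature.MathematicalPhysics.QuantumFieldTheory.qcdTorusExpect β (2 * S + 1) (Function.update mq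 f μ) (A.onTorus (2 * S + 1) v)) (-(Literature.MathematicalPhysics.QuantumFieldTheory.qcdTorusExpect β (2 * S + 1) mq (fun U => A.onTorus (2 * S + 1) v U * ∑ x : Literature.Probability.LatticeModels.TorusSite 4 (2 * S + 1), ∑ a : Fin 3, ∑ α : Fin 4, Literature.MathematicalPhysics.QuantumFieldTheory.qbar (f, (x, a, α)) * Literature.MathematicalPhysics.QuantumFieldTheory.q (f, (x, a, α))) - Literature.MathematicalPhysics.QuantumFieldTheory.qcdTorusExpect β (2 * S + 1) mq (A.onTorus (2 * S + 1) v) * Literature.MathematicalPhysics.QuantumFieldTheory.qcdTorusExpect β (2 * S + 1) mq (fun _ => ∑ x : Literature.Probability.LatticeModels.TorusSite 4 (2 * S + 1), ∑ a : Fin 3, ∑ α : Fin 4, Literature.MathematicalPhysics.QuantumFieldTheory.qbar (f, (x, a, α)) * Literature.MathematicalPhysics.QuantumFieldTheory.q (f, (x, a, α))))) (mq f)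

/-- `MassDerivativeIdentity` holds: proved by `Summit.QuantumFields.QCD.Theorems.massDerivativeIdentity_proof` @ 2196688ca625. -/
theorem MassDerivativeIdentity_holds : MassDerivativeIdentity := _root_.Summit.QuantumFields.QCD.Theorems.massDerivativeIdentity_proof

/-- item stmt-QuantumFields-16904 · assembly · rank 1 · closed · proved by Summit.QuantumFields.QCD.Theorems.eulerDescent_assembly_proof (prover) · by planner
sources: JaffeWitten2000, MontvayMunster1994
[assembly] RayDescent → HonestHeavyAnchor → ChiralCornerSoftness → RetypedContinuumComplement → QCD. -/
@[route_item "route-QuantumFields-EulerDescent"]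
def Assembly : Prop :=
  RayDescent → HonestHeavyAnchor → ChiralCornerSoftness → RetypedContinuumComplement → QCD

-- `Assembly` holds: proved by `Summit.QuantumFields.QCD.Theorems.eulerDescent_assembly_proof` (its module imports this route file, so no `_holds` link can be stated here).

/-! D-0027 §2.1 — DECIDING THEOREM (planner-authored via `route open/edit --closes-file`; by planner-plan-novel-QuantumFields-QCD-829546d5-v2-g10-0 2026-08-16T21:30:19Z):
its hypotheses are this route's items and its conclusion the sub-problem Statement (glue_lint), and it elaborates with this file. -/

@[closes "route-QuantumFields-EulerDescent"] theorem closes (hD : RayDescent) (hA : HonestHeavyAnchor) (hP : ChiralCornerSoftness)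
    (hK : RetypedContinuumComplement) : QCD := by
  have key : ∀ Nf : ℕ, (Nf = 2 ∨ Nf = 3) → QCDOf Nf := by
    intro Nf hNf
    obtain ⟨reg, mc, Mh, hcorner, hpin, hms, haf, hbranch, hMh, hbody⟩ := hA Nf hNf
    have hgap : ∀ m : Fin Nf → ℝ, (∀ f, 0 < m f) →
        ∃ Δ > 0, (reg.scheme m 0 0).HasLatticeMassGap Δ := by
      intro m hm
      set l : ℝ := 1 + ∑ f, Mh / m f with hl
      have hterm : ∀ f, 0 ≤ Mh / m f := fun f => div_nonneg hMh.le (hm f).le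
      have hsum : 0 ≤ ∑ f, Mh / m f := Finset.sum_nonneg fun f _ => hterm f
      have hl1 : 1 ≤ l := by rw [hl]; linarith
      have hlpos : 0 < l := lt_of_lt_of_le one_pos hl1
      have hheavy : ∀ f, Mh ≤ l * m f := by
        intro f
        have h1 : Mh / m f ≤ ∑ g, Mh / m g :=
          Finset.single_le_sum (fun g _ => hterm g) (Finset.mem_univ f)
        have h2 : Mh / m f ≤ l := by rw [hl]; linarith
        have h3 : Mh = Mh / m f * m f := by rw [div_mul_cancel₀ _ (hm f).ne']
        calc Mh = Mh / m f * m f := h3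
          _ ≤ l * m f := by exact mul_le_mul_of_nonneg_right h2 (hm f).le
      obtain ⟨z, shift, T, -, -, -, -, Δ, hΔ, -, hlat⟩ := hbody (fun f => l * m f) hheavy
      have hlat0 : (reg.scheme (fun f => l * m f) 0 0).HasLatticeMassGap Δ := hlat
      refine ⟨Δ / l / 2, by positivity, ?_⟩
      have hlt : Δ / l / 2 < Δ / l := by
        have : 0 < Δ / l := by positivity
        linarith
      exact hD Nf reg mc hcorner hpin hms haf hbranch m hm l hl1 Δ hΔ hlat0 (Δ / l / 2) (by positivity) hlt
    have hchi : reg.IsChiralAtZero := hP Nf hNf reg mc hcorner hpin hms haf hbranch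
    have hfull := hK Nf hNf reg hms haf hbranch ⟨Mh, hMh, hbody⟩ hgap
    exact ⟨reg, hms, hchi, hfull⟩
  exact ⟨key 2 (Or.inl rfl), key 3 (Or.inr rfl)⟩

end Summit.QuantumFields.QCD.Theses.EulerDescent
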